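import Summits.BirchSwinnertonDyer.Rank1Residual.Additive.PotGoodOrdinary
import Summits.BirchSwinnertonDyer.Rank1Residual.AdditivePotMult.Descent
import Literature.NumberTheory.EllipticCurves.NeronLocalHeightPotentialGoodReduction
import Literature.NumberTheory.EllipticCurves.NeronLocalHeightCompletion
import Mathlib.NumberTheory.RamificationInertia.Valuation
import HarnessLib

/-!
# Additive classes X3/X4: Delbourgo's type (G) forces integral `j` — (G) and (M) are disjoint

HONEST FRAMING (cell `b2b-bsdres`, run/shared/lean/b2b/bsd-rank1-residual/, verbatim in every
file): the goal of the cell is to DELETE the COMBINATION-SHAPED residual classes of the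
Birch–Swinnerton-Dyer formula for ALL analytic-rank `≤ 1` elliptic curves over `ℚ` — "full BSD
formula for every rank `≤ 1` curve in class `C`" assembled STRICTLY from published theorems — so
that the rank-`≤ 1` remainder becomes exactly the CONSTRUCTION-SHAPED classes, which are TYPED
(missing-input `Prop`s), NOT attempted. This is not "finishing BSD". Sub-cell `additive-p2`
(X3/X4 at an additive prime, potentially good ORDINARY half): research route; no claim beyond the
stated classes; theorems only, no named fact.

The additive classes X3/X4 are split one level down by POTENTIAL reduction type: potentially
multiplicative (`AdditivePotMult.PotMult`: `Addv ∧ ord_p j < 0`, sub-cell additive-p1) versus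
potentially good, of which Delbourgo's type (G) (`TypeG`: good reduction over a subfield of
`ℚ(ζ_p)`, sub-cell additive-p2) is the tame part with `e ∣ p − 1`. The data-level cells
`SubM`/`SubGord` of `SharpenedStatements.lean` are disjoint by definition; this file proves the
THEORY-level disjointness: **(G) ⇒ `ord_p j(E) ≥ 0`** (`padicValRat_j_nonneg_of_typeG`), hence
`TypeG W p → ¬ PotMult W p`, `ClassX3Gord ∩ ClassX3M = ∅`, `ClassX4Gord ∩ ClassX4M = ∅`. The one
geometric input is the easy half of Silverman *AEC* VII.5.1/VII.5.5, proved here for any number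
field: **good reduction at `w` forces `ord_w j ≥ 0`** (`valuation_j_le_one_of_hasGoodReductionAt`:
on the local minimal model `X` over `L_w`, `j · Δ_X = c₄(X)³` with `Δ_X` a unit and `c₄(X)`
integral); the descent from a place `w ∣ p` of `F ⊆ ℚ(ζ_p)` to `p` is Mathlib's
`valuation_liesOver` (`v(j)^{e(w|p)} = w(j)`).

References: J. H. Silverman, *AEC* VII.1 Prop. 1.3, VII.5 Prop. 5.1, Prop. 5.5; D. Delbourgo,
Compositio Math. 113 (1998) §1.5 (G), §1.2.
-/

noncomputable section

open scoped Classical NumberField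

open WeierstrassCurve IsDedekindDomain IsDedekindDomain.HeightOneSpectrum NumberField
  Literature.NumberTheory.EllipticCurves Literature.NumberTheory.EllipticCurves.Rank1Residual
  Summit.BirchSwinnertonDyer.Rank1Residual.AdditivePotMult

namespace Summit.BirchSwinnertonDyer.Rank1Residual.Additive

/-- **Good reduction forces integral `j`** (Silverman *AEC* VII.5.1 / VII.5.5, easy direction):
if `E/L` has good reduction at the finite place `w`, then `ord_w j(E) ≥ 0`, i.e. `w(j) ≤ 1`:
on the local minimal model `X` over `L_w`, `j · Δ_X = c₄(X)³` with `Δ_X` a `w`-unit and `c₄(X)`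
`w`-integral. -/
theorem valuation_j_le_one_of_hasGoodReductionAt {L : Type*} [Field L] [NumberField L]
    (E : WeierstrassCurve L) [E.IsElliptic] (w : HeightOneSpectrum (𝓞 L))
    (hgood : E.HasGoodReductionAt w) : w.valuation L E.j ≤ 1 := by
  haveI : (E.localMinimalModel w).IsElliptic := E.isElliptic_localMinimalModel w
  have hg : (E.localMinimalModel w).HasGoodReduction (w.adicCompletionIntegers L) := hgood
  haveI := hg.toIsMinimal
  set C : VariableChange (w.adicCompletion L) :=
    ((E.baseChange (w.adicCompletion L)).exists_isMinimal (w.adicCompletionIntegers L)).choose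
  have hX : E.localMinimalModel w = C • E.baseChange (w.adicCompletion L) := rfl
  have hj' : (E.localMinimalModel w).j = algebraMap L (w.adicCompletion L) E.j := by
    show (C • E.baseChange (w.adicCompletion L)).j = _
    rw [variableChange_j]
    exact E.map_j _
  -- `j · Δ_X = c₄(X)³`
  have key : (E.localMinimalModel w).j * (E.localMinimalModel w).Δ =
      (E.localMinimalModel w).c₄ ^ 3 := by
    rw [WeierstrassCurve.j, ← coe_Δ', mul_comm, ← mul_assoc, Units.mul_inv, one_mul]
  -- valuations on `L_w`
  have hc4 : (IsDiscreteValuationRing.maximalIdeal (w.adicCompletionIntegers L)).valuation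
      (w.adicCompletion L) (E.localMinimalModel w).c₄ ≤ 1 := by
    rw [← integralModel_c₄_eq (w.adicCompletionIntegers L) (E.localMinimalModel w)]
    exact valuation_le_one _ _
  have hΔ := hg.goodReduction
  have hjX : (IsDiscreteValuationRing.maximalIdeal (w.adicCompletionIntegers L)).valuation
      (w.adicCompletion L) (algebraMap L (w.adicCompletion L) E.j) ≤ 1 := by
    have h := congrArg ((IsDiscreteValuationRing.maximalIdeal (w.adicCompletionIntegers L)).valuation
      (w.adicCompletion L)) key
    rw [map_mul, hΔ, mul_one, map_pow, hj'] at h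
    rw [h]
    exact pow_le_one₀ zero_le hc4
  -- transfer to `w.valuation L`
  have hE := Literature.NumberTheory.EllipticCurves.isEquiv_valuation_maximalIdeal_valued w
  have h2 : (Valued.v : Valuation (w.adicCompletion L) (WithZero (Multiplicative ℤ)))
      (algebraMap L (w.adicCompletion L) E.j) ≤ 1 :=
    (Valuation.isEquiv_iff_val_le_one.mp hE).mp hjX
  have h3 := valuedAdicCompletion_eq_valuation' w E.j
  rw [← h3]
  exact h2

/-- Above every rational prime `p` there is a finite place of the number field `F`
(`Ideal.exists_maximal_ideal_liesOver_of_isIntegral` for `𝓞 ℚ → 𝓞 F`). -/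
theorem exists_heightOneSpectrum_natCast_mem (F : Type*) [Field F] [NumberField F] (p : ℕ)
    [hp : Fact p.Prime] : ∃ w : HeightOneSpectrum (𝓞 F), (p : 𝓞 F) ∈ w.asIdeal := by
  set v : HeightOneSpectrum (𝓞 ℚ) := (Rat.HeightOneSpectrum.primesEquiv (R := 𝓞 ℚ)).symm ⟨p, hp.out⟩
    with hvdef
  have hpv : (p : 𝓞 ℚ) ∈ v.asIdeal :=
    (natCast_mem_asIdeal_iff_eq_primesEquiv_symm v hp.out).mpr rfl
  haveI := v.isMaximal
  obtain ⟨Q, hQmax, hQover⟩ :=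
    Ideal.exists_maximal_ideal_liesOver_of_isIntegral (S := 𝓞 F) v.asIdeal
  haveI := hQover
  refine ⟨⟨Q, hQmax.isPrime, Ideal.ne_bot_of_liesOver_of_ne_bot v.ne_bot Q⟩, ?_⟩
  have h : (p : 𝓞 ℚ) ∈ Q.under (𝓞 ℚ) := by rw [← hQover.over]; exact hpv
  rw [Ideal.under_def, Ideal.mem_comap, map_natCast] at h
  exact h

/-- **Type (G) forces integral `j`: `ord_p j(E) ≥ 0`.** If `E_F` has good reduction at the places
above `p` for some subfield `F` of a `p`-th cyclotomic field (Delbourgo's (G), `TypeG W p`), then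
`j(E)` is `p`-integral: pick `w ∣ p` in `F`; good reduction gives `w(j) ≤ 1`
(`valuation_j_le_one_of_hasGoodReductionAt`), and `v_p(j)^{e(w|p)} = w(j)` (`valuation_liesOver`)
with `e(w|p) ≥ 1` gives `v_p(j) ≤ 1`, i.e. `ord_p j ≥ 0`. (Only "some finite extension with good
reduction above `p`" is used; the cyclotomic constraint of (G) is not needed for this direction —
Silverman *AEC* VII.5.5, "potential good reduction ⇒ integral `j`".) -/
theorem padicValRat_j_nonneg_of_typeG (W : WeierstrassCurve ℚ) [W.IsElliptic] (p : ℕ)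
    [hp : Fact p.Prime] (h : TypeG W p) : 0 ≤ padicValRat p W.j := by
  by_cases hj0 : W.j = 0
  · simp [hj0]
  obtain ⟨L, _, _, _, F, hF⟩ := h
  haveI : NumberField F := NumberField.of_module_finite ℚ F
  obtain ⟨w, hw⟩ := exists_heightOneSpectrum_natCast_mem F p
  haveI : (W.baseChange F).IsElliptic := by rw [baseChange]; infer_instance
  have hjw := valuation_j_le_one_of_hasGoodReductionAt (W.baseChange F) w (hF w hw)
  have hjF : (W.baseChange F).j = algebraMap ℚ F W.j := W.map_j (algebraMap ℚ F)
  rw [hjF] at hjw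
  -- the place of `ℤ` below `w` is `(p)`
  set v : HeightOneSpectrum ℤ := (Rat.HeightOneSpectrum.primesEquiv (R := ℤ)).symm ⟨p, hp.out⟩
    with hvdef
  have hv : Rat.HeightOneSpectrum.natGenerator v = p :=
    congrArg Subtype.val ((Rat.HeightOneSpectrum.primesEquiv (R := ℤ)).apply_symm_apply ⟨p, hp.out⟩)
  have hunder : w.asIdeal.under ℤ = v.asIdeal := by
    have hle : v.asIdeal ≤ w.asIdeal.under ℤ := by
      rw [Rat.HeightOneSpectrum.asIdeal_eq_span_natGenerator_int, hv, Ideal.span_le,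
        Set.singleton_subset_iff, SetLike.mem_coe, Ideal.under_def, Ideal.mem_comap, map_natCast]
      exact hw
    exact (v.isMaximal.eq_of_le (Ideal.IsPrime.ne_top inferInstance) hle).symm
  haveI : w.asIdeal.LiesOver v.asIdeal := ⟨hunder.symm⟩
  have he : v.asIdeal.ramificationIdx' w.asIdeal ≠ 0 :=
    Ideal.IsDedekindDomain.ramificationIdx'_ne_zero_of_liesOver w.asIdeal v.ne_bot
  have hvj : v.valuation ℚ W.j ≤ 1 := by
    rw [← pow_le_one_iff he, valuation_liesOver (K := ℚ) (L := F) v w W.j]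
    exact hjw
  rw [Rat.HeightOneSpectrum.valuation_eq_exp_neg_padicValRat v hj0, hv, ← WithZero.exp_zero,
    WithZero.exp_le_exp] at hvj
  linarith

/-- **(G)-ordinary forces integral `j`** (from `TypeGOrd.typeG`). -/
theorem padicValRat_j_nonneg_of_typeGOrd (W : WeierstrassCurve ℚ) [W.IsElliptic] (p : ℕ)
    [Fact p.Prime] (h : TypeGOrd W p) : 0 ≤ padicValRat p W.j :=
  padicValRat_j_nonneg_of_typeG W p h.typeG

/-- **(G) and (M) are disjoint**: a pair of Delbourgo type (G) is not potentially multiplicative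
(`AdditivePotMult.PotMult = Addv ∧ ord_p j < 0`). Silverman *AEC* VII.5.5. -/
theorem not_potMult_of_typeG (W : WeierstrassCurve ℚ) [W.IsElliptic] (p : ℕ) [Fact p.Prime]
    (h : TypeG W p) : ¬ PotMult W p :=
  fun hm => not_lt.mpr (padicValRat_j_nonneg_of_typeG W p h) hm.2

/-- **X3♯(G-ord) ∩ X3♯(M) = ∅** (the two sub-cells of the additive Eisenstein class X3 owned by
additive-p2 / additive-p1 are disjoint at THEORY level, not only as data cells). -/
theorem not_classX3M_of_classX3Gord (W : WeierstrassCurve ℚ) [W.IsElliptic] [W.IsGloballyMinimal]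
    (p : ℕ) [Fact p.Prime] (h : ClassX3Gord W p) : ¬ ClassX3M W p :=
  fun hM => not_potMult_of_typeG W p h.typeGOrd.typeG hM.potMult

/-- **X4♯(G-ord) ∩ X4(M) = ∅**. -/
theorem not_classX4M_of_classX4Gord (W : WeierstrassCurve ℚ) [W.IsElliptic] (p : ℕ)
    [Fact p.Prime] (h : ClassX4Gord W p) : ¬ ClassX4M W p :=
  fun hM => not_potMult_of_typeG W p h.typeGOrd.typeG hM.potMult

end Summit.BirchSwinnertonDyer.Rank1Residual.Additive

end
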